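import Literature.Analysis.Distribution.ExpCutoffCalculus
import Literature.Analysis.Complex.HolomorphicParametricIntegral
import Mathlib.Analysis.Distribution.SchwartzSpace.Fourier
import HarnessLib

/-!
# Exponential multipliers `θ(⟨w, v⟩) e^{2πiκ⟨w, v⟩}` on Schwartz space and their inverse Fourier transforms

Topic `Literature/Analysis/FunctionSpaces`. Support file for the half-space (Paley–Wiener) part of
the spectral support of boundary values of functions holomorphic in a tube (Streater–Wightman
(1964), Thm. 2-8 / Vladimirov (1966), §26.3: the Fourier transform of the boundary value of a
function of polynomial growth in `ℝⁿ + iC` is carried by the dual cone). The mechanism is a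
one-parameter **complex** family of multipliers on the Fourier side: for a smooth compactly
supported `θ : ℝ → ℂ`, a vector `v` of a finite-dimensional real inner product space `E` and
`κ ∈ ℂ`,

  `m_κ(w) = θ(⟨w, v⟩) · e^{2πiκ⟨w, v⟩}`,

a smooth function of temperate growth (`hasTemperateGrowth_expMult`), so that `m_κ G ∈ 𝓢` for
`G ∈ 𝓢(E, ℂ)` (`SchwartzMap.smulLeftCLM`). We prove:

* `exists_dsup_expMult_le` — **jet bounds**: `‖Dⁿ m_κ(w)‖ ≤ A (1 + ‖κ‖)ⁿ e^{−2π Im κ ⟨w, v⟩}`, and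
  `m_κ` vanishes to all orders where `⟨w, v⟩ ∉ supp θ` (Leibniz + chain rule, the `dsup` calculus
  of `ExpCutoffCalculus`);
* `exists_seminorm_smulLeftCLM_expMult_le` — **Schwartz seminorm bounds** for `m_κ G`:
  `p_{k,n}(m_κ G) ≤ A (1 + ‖κ‖)ⁿ ρ · sup_{≤ (k,n)} p(G)` whenever `e^{−2π Im κ r} ≤ ρ` on `supp θ`;
* `exists_one_add_norm_pow_mul_norm_fourierInv_le` — continuity of `𝓕⁻¹` on `𝓢` in weighted
  sup-norm form, and `exists_decay_fourierInv_smulLeftCLM_expMult` — the **uniform decay**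
  `(1 + ‖x‖)ᴹ |𝓕⁻¹(m_κ G)(x)| ≤ K (1 + ‖κ‖)^{N₀} ρ`;
* `fourierInv_smulLeftCLM_expMult_ofReal` — the **Fourier shift**: for real `κ = u`,
  `𝓕⁻¹(m_u G)(x) = 𝓕⁻¹(m_0 G)(x + u v)`;
* `differentiable_fourierInv_smulLeftCLM_expMult` — **holomorphy**: `κ ↦ 𝓕⁻¹(m_κ G)(x)` is entire
  (dominated holomorphic parameter integral);
* the two standard choices of `ρ`: `exp_neg_le_exp_norm` (`ρ = e^{2π‖κ‖R}`, `supp θ ⊆ [−R, R]`) and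
  `exp_neg_le_exp_neg_of_le` (`κ = is`, `s ≥ 0`, `supp θ ⊆ [ε, ∞)`: `ρ = e^{−2πsε}`, exponential
  decay — the Paley–Wiener mechanism).

## References

* R. F. Streater, A. S. Wightman, *PCT, Spin and Statistics, and All That* (1964), §2-3,
  Thms. 2-6–2-8. [StreaterWightman1964]
* V. S. Vladimirov, *Methods of the Theory of Functions of Many Complex Variables* (1966),
  §26.3. [Vladimirov1966]

## Mathlib

`SchwartzMap.smulLeftCLM`, `Function.HasTemperateGrowth.comp`,
`HasCompactSupport.hasTemperateGrowth`, `Real.fourierInv_eq'`, `SchwartzMap.fourierInv_coe`,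
`Seminorm.bound_of_continuous` (continuity of `𝓕⁻¹ : 𝓢 →L 𝓢` in seminorm form),
`ContinuousLinearMap.iteratedFDeriv_comp_right`; tree: the `dsup` calculus
(`Literature.Analysis.Distribution.dsup_mul_le`, `dsup_cexp_comp_le`, `one_add_pow_mul_dsup_le`)
and `Literature.Analysis.Complex.differentiableOn_integral_of_dominated`.
-/

noncomputable section

open MeasureTheory Filter Set Metric Complex FourierTransform
open scoped Topology SchwartzMap RealInnerProductSpace FourierTransform ContDiff
open Literature.Analysis.Distribution

namespace Literature.Analysis.FunctionSpaces

variable {E : Type*} [NormedAddCommGroup E] [InnerProductSpace ℝ E]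

/-! ### The multiplier and its temperate growth -/

/-- The **exponential multiplier** `m_κ(w) = θ(⟨w, v⟩) e^{2πiκ⟨w, v⟩}` attached to a profile
`θ : ℝ → ℂ`, a vector `v` and a complex parameter `κ`. [folklore] -/
def expMult (θ : ℝ → ℂ) (v : E) (κ : ℂ) (w : E) : ℂ :=
  θ ⟪w, v⟫ * cexp (2 * Real.pi * I * κ * (⟪w, v⟫ : ℂ))

/-- Values of the multiplier. [folklore] -/
theorem expMult_apply (θ : ℝ → ℂ) (v : E) (κ : ℂ) (w : E) :
    expMult θ v κ w = θ ⟪w, v⟫ * cexp (2 * Real.pi * I * κ * (⟪w, v⟫ : ℂ)) := rfl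

/-- The one-variable profile `g_κ(r) = θ(r) e^{2πiκr}` behind the multiplier. [folklore] -/
theorem expMult_eq_comp (θ : ℝ → ℂ) (v : E) (κ : ℂ) :
    expMult θ v κ = (fun r : ℝ => θ r * cexp (2 * Real.pi * I * κ * (r : ℂ))) ∘ fun w : E => ⟪w, v⟫ :=
  rfl

/-- The profile `g_κ` is smooth. [folklore] -/
theorem contDiff_expMult_profile {θ : ℝ → ℂ} (hθ : ContDiff ℝ ∞ θ) (κ : ℂ) :
    ContDiff ℝ ∞ fun r : ℝ => θ r * cexp (2 * Real.pi * I * κ * (r : ℂ)) :=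
  hθ.mul ((Complex.contDiff_exp (𝕜 := ℝ)).comp (contDiff_const.mul Complex.ofRealCLM.contDiff))

/-- The profile `g_κ` has compact support (inside `supp θ`). [folklore] -/
theorem hasCompactSupport_expMult_profile {θ : ℝ → ℂ} (hθc : HasCompactSupport θ) (κ : ℂ) :
    HasCompactSupport fun r : ℝ => θ r * cexp (2 * Real.pi * I * κ * (r : ℂ)) :=
  hθc.mul_right

/-- `w ↦ ⟨w, v⟩` is smooth. [folklore] -/
theorem contDiff_inner_left (v : E) : ContDiff ℝ ∞ fun w : E => ⟪w, v⟫ :=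
  ((innerSL ℝ).flip v).contDiff

/-- **The multiplier has temperate growth** (a compactly supported smooth profile composed with a
linear form), so that `m_κ G` is a Schwartz function for Schwartz `G`. [folklore] -/
theorem hasTemperateGrowth_expMult {θ : ℝ → ℂ} (hθ : ContDiff ℝ ∞ θ) (hθc : HasCompactSupport θ)
    (v : E) (κ : ℂ) : (expMult θ v κ).HasTemperateGrowth := by
  rw [expMult_eq_comp]
  exact ((hasCompactSupport_expMult_profile hθc κ).hasTemperateGrowth
    (contDiff_expMult_profile hθ κ)).comp ((innerSL ℝ).flip v).hasTemperateGrowth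

/-- The multiplier is smooth. [folklore] -/
theorem contDiff_expMult {θ : ℝ → ℂ} (hθ : ContDiff ℝ ∞ θ) (v : E) (κ : ℂ) :
    ContDiff ℝ ∞ (expMult θ v κ) := by
  rw [expMult_eq_comp]
  exact (contDiff_expMult_profile hθ κ).comp (contDiff_inner_left v)

/-- Values of `m_κ G`. [folklore] -/
theorem smulLeftCLM_expMult_apply {θ : ℝ → ℂ} (hθ : ContDiff ℝ ∞ θ) (hθc : HasCompactSupport θ)
    (v : E) (κ : ℂ) (G : 𝓢(E, ℂ)) (w : E) :
    SchwartzMap.smulLeftCLM ℂ (expMult θ v κ) G w = expMult θ v κ w * G w := by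
  rw [SchwartzMap.smulLeftCLM_apply_apply (hasTemperateGrowth_expMult hθ hθc v κ), smul_eq_mul]

/-- The multiplier vanishes where `⟨w, v⟩ ∉ supp θ`, to all orders: its topological support lies
in `{w | ⟨w, v⟩ ∈ tsupport θ}`. [folklore] -/
theorem tsupport_expMult_subset (θ : ℝ → ℂ) (v : E) (κ : ℂ) :
    tsupport (expMult θ v κ) ⊆ {w : E | ⟪w, v⟫ ∈ tsupport θ} := by
  have h1 : Function.support (expMult θ v κ) ⊆ (fun w : E => ⟪w, v⟫) ⁻¹' Function.support θ := by
    intro w hw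
    simp only [Function.mem_support, expMult_apply, ne_eq, mul_eq_zero, not_or] at hw
    exact hw.1
  refine (closure_mono h1).trans ?_
  exact ((continuous_id.inner continuous_const).closure_preimage_subset _)

/-! ### Jet bounds -/

/-- The jets of `w ↦ θ(⟨w, v⟩)` are bounded (compactly supported smooth profile, linear inner
map: `‖Dⁱ(θ ∘ ℓ)‖ ≤ ‖Dⁱθ‖_∞ ‖v‖ⁱ`). [folklore] -/
theorem exists_dsup_comp_inner_le {θ : ℝ → ℂ} (hθ : ContDiff ℝ ∞ θ) (hθc : HasCompactSupport θ)
    (v : E) (n : ℕ) : ∃ A : ℝ, 0 ≤ A ∧ ∀ w : E, dsup n (fun w : E => θ ⟪w, v⟫) w ≤ A := by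
  set ℓ : E →L[ℝ] ℝ := (innerSL ℝ).flip v with hℓ
  have hℓw : ∀ w, ℓ w = ⟪w, v⟫ := fun w => by
    rw [hℓ, ContinuousLinearMap.flip_apply, innerSL_apply_apply]
  -- bounds for the derivatives of `θ`
  have hbd : ∀ i : ℕ, ∃ B : ℝ, 0 ≤ B ∧ ∀ r, ‖iteratedFDeriv ℝ i θ r‖ ≤ B := by
    intro i
    obtain ⟨B, hB⟩ := (hθc.iteratedFDeriv i).exists_bound_of_continuous
      (hθ.continuous_iteratedFDeriv (mod_cast le_top))
    exact ⟨max B 0, le_max_right _ _, fun r => (hB r).trans (le_max_left _ _)⟩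
  choose B hB0 hB using hbd
  refine ⟨(Finset.range (n + 1)).sum fun i => B i * ‖ℓ‖ ^ i, Finset.sum_nonneg fun i _ => by
    have := hB0 i; positivity, fun w => dsup_le_iff.2 fun i hi => ?_⟩
  have hcomp : (fun w : E => θ ⟪w, v⟫) = θ ∘ ℓ := by funext w; simp [hℓw]
  rw [hcomp, ℓ.iteratedFDeriv_comp_right hθ w (mod_cast le_top)]
  calc ‖(iteratedFDeriv ℝ i θ (ℓ w)).compContinuousLinearMap fun _ => ℓ‖
      ≤ ‖iteratedFDeriv ℝ i θ (ℓ w)‖ * ∏ _j : Fin i, ‖ℓ‖ :=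
        ContinuousMultilinearMap.norm_compContinuousLinearMap_le _ _
    _ ≤ B i * ‖ℓ‖ ^ i := by
        rw [Finset.prod_const, Finset.card_univ, Fintype.card_fin]
        exact mul_le_mul_of_nonneg_right (hB i _) (by positivity)
    _ ≤ (Finset.range (n + 1)).sum fun i => B i * ‖ℓ‖ ^ i := by
        refine Finset.single_le_sum (f := fun i => B i * ‖ℓ‖ ^ i) (fun j _ => by
          have := hB0 j; positivity) (Finset.mem_range.2 (Nat.lt_succ_of_le hi))

/-- The linear exponent of the multiplier as a real-linear complex form:
`L_κ(w) = 2πiκ⟨w, v⟩`. [folklore] -/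
theorem expMult_exponent_eq (v : E) (κ : ℂ) (w : E) :
    ((2 * Real.pi * I * κ) • (Complex.ofRealCLM.comp ((innerSL ℝ).flip v)) : E →L[ℝ] ℂ) w =
      2 * Real.pi * I * κ * (⟪w, v⟫ : ℂ) := by
  rw [FunLike.coe_smul, Pi.smul_apply, ContinuousLinearMap.comp_apply,
    ContinuousLinearMap.flip_apply, innerSL_apply_apply, Complex.ofRealCLM_apply, smul_eq_mul]

/-- Norm of the exponent form: `‖L_κ‖ ≤ 2π ‖κ‖ ‖v‖`. [folklore] -/
theorem norm_expMult_exponent_le (v : E) (κ : ℂ) :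
    ‖((2 * Real.pi * I * κ) • (Complex.ofRealCLM.comp ((innerSL ℝ).flip v)) : E →L[ℝ] ℂ)‖ ≤
      2 * Real.pi * ‖κ‖ * ‖v‖ := by
  refine ContinuousLinearMap.opNorm_le_bound _ (by positivity) fun w => ?_
  rw [expMult_exponent_eq]
  have h1 : |⟪w, v⟫| ≤ ‖w‖ * ‖v‖ := abs_real_inner_le_norm w v
  have h2 : ‖2 * (Real.pi : ℂ) * I * κ * (⟪w, v⟫ : ℂ)‖ = 2 * Real.pi * ‖κ‖ * |⟪w, v⟫| := by
    rw [norm_mul, norm_mul, norm_mul, norm_mul, Complex.norm_I, Complex.norm_real,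
      Complex.norm_real, Real.norm_eq_abs, Real.norm_eq_abs, abs_of_pos Real.pi_pos,
      Complex.norm_two]
    ring
  rw [h2]
  calc 2 * Real.pi * ‖κ‖ * |⟪w, v⟫| ≤ 2 * Real.pi * ‖κ‖ * (‖w‖ * ‖v‖) := by gcongr
    _ = 2 * Real.pi * ‖κ‖ * ‖v‖ * ‖w‖ := by ring

/-- **Jet bound for the multiplier**: there is `A ≥ 0` (depending on `θ, v, n`) with
`dsup n m_κ (w) ≤ A (1 + ‖κ‖)ⁿ e^{−2π Im κ ⟨w, v⟩}` for all `κ, w` (Leibniz for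
`θ(⟨w, v⟩) · e^{L_κ(w)}`, `Re L_κ(w) = −2π Im κ ⟨w, v⟩`). [folklore] -/
theorem exists_dsup_expMult_le {θ : ℝ → ℂ} (hθ : ContDiff ℝ ∞ θ) (hθc : HasCompactSupport θ)
    (v : E) (n : ℕ) : ∃ A : ℝ, 0 ≤ A ∧ ∀ (κ : ℂ) (w : E),
      dsup n (expMult θ v κ) w ≤ A * (1 + ‖κ‖) ^ n * Real.exp (-(2 * Real.pi * κ.im * ⟪w, v⟫)) := by
  obtain ⟨A₀, hA₀, hθv⟩ := exists_dsup_comp_inner_le hθ hθc v n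
  refine ⟨2 ^ n * A₀ * (1 + 2 * Real.pi * ‖v‖) ^ n, by positivity, fun κ w => ?_⟩
  set L : E →L[ℝ] ℂ := (2 * Real.pi * I * κ) • (Complex.ofRealCLM.comp ((innerSL ℝ).flip v))
    with hL
  have hLw : ∀ w, L w = 2 * Real.pi * I * κ * (⟪w, v⟫ : ℂ) := expMult_exponent_eq v κ
  have hfun : expMult θ v κ = fun w => θ ⟪w, v⟫ * cexp (L w) := by
    funext w; rw [expMult_apply, hLw]
  have hre : (L w).re = -(2 * Real.pi * κ.im * ⟪w, v⟫) := by
    rw [hLw]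
    simp [Complex.mul_re, Complex.mul_im]
  rw [hfun]
  have h1 := dsup_mul_le ((hθ.comp (contDiff_inner_left v))) (contDiff_cexp_comp L) n w
  have h2 := dsup_cexp_comp_le L n w
  have h3 := hθv w
  have hLn : ‖L‖ ≤ 2 * Real.pi * ‖κ‖ * ‖v‖ := norm_expMult_exponent_le v κ
  have h4 : (1 + ‖L‖) ^ n ≤ ((1 + ‖κ‖) * (1 + 2 * Real.pi * ‖v‖)) ^ n := by
    refine pow_le_pow_left₀ (by positivity) ?_ n
    nlinarith [norm_nonneg κ, norm_nonneg v, Real.pi_pos, mul_nonneg (norm_nonneg κ) (norm_nonneg v)]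
  have hd0 : 0 ≤ dsup n (fun y : E => cexp (L y)) w := dsup_nonneg _ _ _
  calc dsup n (fun w => θ ⟪w, v⟫ * cexp (L w)) w
      ≤ 2 ^ n * dsup n (fun w : E => θ ⟪w, v⟫) w * dsup n (fun y => cexp (L y)) w := h1
    _ ≤ 2 ^ n * A₀ * ((1 + ‖L‖) ^ n * Real.exp (L w).re) :=
        mul_le_mul (mul_le_mul_of_nonneg_left h3 (by positivity)) h2 hd0 (by positivity)
    _ ≤ 2 ^ n * A₀ * (((1 + ‖κ‖) * (1 + 2 * Real.pi * ‖v‖)) ^ n * Real.exp (L w).re) := by gcongr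
    _ = 2 ^ n * A₀ * (1 + 2 * Real.pi * ‖v‖) ^ n * (1 + ‖κ‖) ^ n *
        Real.exp (-(2 * Real.pi * κ.im * ⟪w, v⟫)) := by rw [hre, mul_pow]; ring

/-- The jets of the multiplier vanish where `⟨w, v⟩ ∉ supp θ`. [folklore] -/
theorem dsup_expMult_eq_zero {θ : ℝ → ℂ} (v : E) (κ : ℂ) (n : ℕ) {w : E}
    (hw : ⟪w, v⟫ ∉ tsupport θ) : dsup n (expMult θ v κ) w = 0 :=
  dsup_eq_zero_of_notMem_tsupport fun h => hw (tsupport_expMult_subset θ v κ h)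

/-- **Jet bound with a weight `ρ` dominating `e^{−2π Im κ r}` on `supp θ`**:
`dsup n m_κ ≤ A (1 + ‖κ‖)ⁿ ρ` everywhere. [folklore] -/
theorem exists_dsup_expMult_le_of_weight {θ : ℝ → ℂ} (hθ : ContDiff ℝ ∞ θ)
    (hθc : HasCompactSupport θ) (v : E) (n : ℕ) : ∃ A : ℝ, 0 ≤ A ∧ ∀ (κ : ℂ) (ρ : ℝ), 0 ≤ ρ →
      (∀ r ∈ tsupport θ, Real.exp (-(2 * Real.pi * κ.im * r)) ≤ ρ) →
        ∀ w : E, dsup n (expMult θ v κ) w ≤ A * (1 + ‖κ‖) ^ n * ρ := by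
  obtain ⟨A, hA, h⟩ := exists_dsup_expMult_le hθ hθc v n
  refine ⟨A, hA, fun κ ρ hρ hw w => ?_⟩
  by_cases hmem : ⟪w, v⟫ ∈ tsupport θ
  · exact (h κ w).trans (by gcongr; exact hw _ hmem)
  · rw [dsup_expMult_eq_zero v κ n hmem]; positivity

/-! ### Schwartz seminorm bounds for `m_κ G` -/

/-- **Seminorm bound**: `p_{k,n}(m_κ G) ≤ A (1 + ‖κ‖)ⁿ ρ · 2ᵏ sup_{≤ (k,n)} p(G)` whenever
`e^{−2π Im κ r} ≤ ρ` on `supp θ` (Leibniz: `dsup n (m_κ G) ≤ 2ⁿ dsup n m_κ · dsup n G`). [folklore] -/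
theorem exists_seminorm_smulLeftCLM_expMult_le {θ : ℝ → ℂ} (hθ : ContDiff ℝ ∞ θ)
    (hθc : HasCompactSupport θ) (v : E) (k n : ℕ) : ∃ A : ℝ, 0 ≤ A ∧ ∀ (κ : ℂ) (ρ : ℝ), 0 ≤ ρ →
      (∀ r ∈ tsupport θ, Real.exp (-(2 * Real.pi * κ.im * r)) ≤ ρ) → ∀ G : 𝓢(E, ℂ),
        SchwartzMap.seminorm ℂ k n (SchwartzMap.smulLeftCLM ℂ (expMult θ v κ) G) ≤
          A * (1 + ‖κ‖) ^ n * ρ * (Finset.Iic (k, n)).sup (schwartzSeminormFamily ℂ E ℂ) G := by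
  obtain ⟨A, hA, hm⟩ := exists_dsup_expMult_le_of_weight hθ hθc v n
  refine ⟨2 ^ n * 2 ^ k * A, by positivity, fun κ ρ hρ hw G => ?_⟩
  refine SchwartzMap.seminorm_le_bound ℂ k n _ (by positivity) fun w => ?_
  have hcoe : ⇑(SchwartzMap.smulLeftCLM ℂ (expMult θ v κ) G) = fun w => expMult θ v κ w * G w :=
    funext fun w => smulLeftCLM_expMult_apply hθ hθc v κ G w
  rw [hcoe]
  have h1 : ‖iteratedFDeriv ℝ n (fun w => expMult θ v κ w * G w) w‖ ≤
      dsup n (fun w => expMult θ v κ w * G w) w := norm_iteratedFDeriv_le_dsup le_rfl _ w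
  have h2 := dsup_mul_le (contDiff_expMult hθ v κ) (G.smooth ⊤) n w
  have h3 := hm κ ρ hρ hw w
  have h4 := BddCutoff.one_add_pow_mul_dsup_le (𝕜 := ℂ) k n G w
  have hxk : ‖w‖ ^ k ≤ (1 + ‖w‖) ^ k := by gcongr; linarith [norm_nonneg w]
  have hdG : 0 ≤ dsup n (⇑G) w := dsup_nonneg _ _ _
  calc ‖w‖ ^ k * ‖iteratedFDeriv ℝ n (fun w => expMult θ v κ w * G w) w‖
      ≤ (1 + ‖w‖) ^ k * (2 ^ n * dsup n (expMult θ v κ) w * dsup n (⇑G) w) := by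
        gcongr; exact h1.trans h2
    _ ≤ (1 + ‖w‖) ^ k * (2 ^ n * (A * (1 + ‖κ‖) ^ n * ρ) * dsup n (⇑G) w) := by gcongr
    _ = 2 ^ n * (A * (1 + ‖κ‖) ^ n * ρ) * ((1 + ‖w‖) ^ k * dsup n (⇑G) w) := by ring
    _ ≤ 2 ^ n * (A * (1 + ‖κ‖) ^ n * ρ) *
        (2 ^ k * (Finset.Iic (k, n)).sup (schwartzSeminormFamily ℂ E ℂ) G) := by gcongr
    _ = 2 ^ n * 2 ^ k * A * (1 + ‖κ‖) ^ n * ρ *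
        (Finset.Iic (k, n)).sup (schwartzSeminormFamily ℂ E ℂ) G := by ring

/-! ### Decay of the inverse Fourier transform -/

section Fourier

variable [FiniteDimensional ℝ E] [MeasurableSpace E] [BorelSpace E]

/-- **Continuity of `𝓕⁻¹` on `𝓢` in weighted sup-norm form**: for every `M` there are finitely
many Schwartz seminorms and `C ≥ 0` with `(1 + ‖x‖)ᴹ ‖𝓕⁻¹ψ(x)‖ ≤ C (s.sup p)(ψ)` for all `ψ`
(`𝓕⁻¹ : 𝓢 →L 𝓢` is continuous; `Seminorm.bound_of_continuous`). [folklore] -/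
theorem exists_one_add_norm_pow_mul_norm_fourierInv_le (M : ℕ) :
    ∃ (s : Finset (ℕ × ℕ)) (C : ℝ), 0 ≤ C ∧ ∀ (ψ : 𝓢(E, ℂ)) (x : E),
      (1 + ‖x‖) ^ M * ‖(𝓕⁻ ψ : 𝓢(E, ℂ)) x‖ ≤ C * (s.sup (schwartzSeminormFamily ℂ E ℂ)) ψ := by
  set Finv : 𝓢(E, ℂ) →L[ℂ] 𝓢(E, ℂ) := FourierTransform.fourierInvCLM ℂ 𝓢(E, ℂ) with hFinv
  have hFinv_apply : ∀ ψ : 𝓢(E, ℂ), Finv ψ = 𝓕⁻ ψ := fun ψ => rfl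
  set q₀ : Seminorm ℂ 𝓢(E, ℂ) := (Finset.Iic (M, 0)).sup (schwartzSeminormFamily ℂ E ℂ) with hq₀
  set q : Seminorm ℂ 𝓢(E, ℂ) := q₀.comp (Finv : 𝓢(E, ℂ) →ₗ[ℂ] 𝓢(E, ℂ)) with hq
  have hq₀c : Continuous q₀ := by
    rw [hq₀]
    exact Seminorm.continuous_finsetSup fun i _ =>
      (schwartz_withSeminorms ℂ E ℂ).continuous_seminorm i
  have hqc : Continuous q := hq₀c.comp Finv.continuous
  obtain ⟨s, C, _, hle⟩ := Seminorm.bound_of_continuous (schwartz_withSeminorms ℂ E ℂ) q hqc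
  refine ⟨s, 2 ^ M * C, by positivity, fun ψ x => ?_⟩
  have h1 : (1 + ‖x‖) ^ M * ‖(𝓕⁻ ψ : 𝓢(E, ℂ)) x‖ ≤ 2 ^ M * q₀ (𝓕⁻ ψ) := by
    have h := SchwartzMap.one_add_le_sup_seminorm_apply (𝕜 := ℂ) (m := (M, 0)) (k := M) (n := 0)
      le_rfl le_rfl (𝓕⁻ ψ : 𝓢(E, ℂ)) x
    rwa [norm_iteratedFDeriv_zero] at h
  have h2 : q₀ (𝓕⁻ ψ) ≤ C * (s.sup (schwartzSeminormFamily ℂ E ℂ)) ψ := by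
    have h := hle ψ
    simp only [hq, Seminorm.comp_apply, ContinuousLinearMap.coe_coe, hFinv_apply] at h
    exact h
  calc (1 + ‖x‖) ^ M * ‖(𝓕⁻ ψ : 𝓢(E, ℂ)) x‖ ≤ 2 ^ M * q₀ (𝓕⁻ ψ) := h1
    _ ≤ 2 ^ M * (C * (s.sup (schwartzSeminormFamily ℂ E ℂ)) ψ) := by gcongr
    _ = 2 ^ M * C * (s.sup (schwartzSeminormFamily ℂ E ℂ)) ψ := by ring

/-- **Uniform decay of `𝓕⁻¹(m_κ G)`**: for every `M` and `G` there are `K ≥ 0` and `N₀` with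
`(1 + ‖x‖)ᴹ ‖𝓕⁻¹(m_κ G)(x)‖ ≤ K (1 + ‖κ‖)^{N₀} ρ` for all `x`, all `κ` and every weight `ρ ≥ 0`
dominating `e^{−2π Im κ r}` on `supp θ`. [folklore] -/
theorem exists_decay_fourierInv_smulLeftCLM_expMult {θ : ℝ → ℂ} (hθ : ContDiff ℝ ∞ θ)
    (hθc : HasCompactSupport θ) (v : E) (M : ℕ) (G : 𝓢(E, ℂ)) :
    ∃ (K : ℝ) (N₀ : ℕ), 0 ≤ K ∧ ∀ (κ : ℂ) (ρ : ℝ), 0 ≤ ρ →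
      (∀ r ∈ tsupport θ, Real.exp (-(2 * Real.pi * κ.im * r)) ≤ ρ) → ∀ x : E,
        (1 + ‖x‖) ^ M * ‖(𝓕⁻ (SchwartzMap.smulLeftCLM ℂ (expMult θ v κ) G) : 𝓢(E, ℂ)) x‖ ≤
          K * (1 + ‖κ‖) ^ N₀ * ρ := by
  obtain ⟨s, C, hC, hF⟩ := exists_one_add_norm_pow_mul_norm_fourierInv_le (E := E) M
  have hi : ∀ i : ℕ × ℕ, ∃ A : ℝ, 0 ≤ A ∧ ∀ (κ : ℂ) (ρ : ℝ), 0 ≤ ρ →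
      (∀ r ∈ tsupport θ, Real.exp (-(2 * Real.pi * κ.im * r)) ≤ ρ) → ∀ G : 𝓢(E, ℂ),
        SchwartzMap.seminorm ℂ i.1 i.2 (SchwartzMap.smulLeftCLM ℂ (expMult θ v κ) G) ≤
          A * (1 + ‖κ‖) ^ i.2 * ρ * (Finset.Iic (i.1, i.2)).sup (schwartzSeminormFamily ℂ E ℂ) G :=
    fun i => exists_seminorm_smulLeftCLM_expMult_le hθ hθc v i.1 i.2
  choose A hA0 hA using hi
  set N₀ : ℕ := s.sup fun i => i.2 with hN₀
  set K : ℝ := C * ∑ i ∈ s, A i * (Finset.Iic (i.1, i.2)).sup (schwartzSeminormFamily ℂ E ℂ) G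
    with hK
  set S : ℝ := ∑ i ∈ s, A i * (Finset.Iic (i.1, i.2)).sup (schwartzSeminormFamily ℂ E ℂ) G with hS
  have hS0 : 0 ≤ S := Finset.sum_nonneg fun i _ => mul_nonneg (hA0 i) (apply_nonneg _ _)
  refine ⟨K, N₀, mul_nonneg hC hS0, fun κ ρ hρ hw x => ?_⟩
  have h1 := hF (SchwartzMap.smulLeftCLM ℂ (expMult θ v κ) G) x
  have h2 : (s.sup (schwartzSeminormFamily ℂ E ℂ)) (SchwartzMap.smulLeftCLM ℂ (expMult θ v κ) G) ≤
      S * (1 + ‖κ‖) ^ N₀ * ρ := by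
    refine Seminorm.finset_sup_apply_le (by positivity) fun i hi => ?_
    rw [SchwartzMap.schwartzSeminormFamily_apply]
    have hpow : (1 + ‖κ‖) ^ i.2 ≤ (1 + ‖κ‖) ^ N₀ :=
      pow_le_pow_right₀ (by linarith [norm_nonneg κ]) (Finset.le_sup (f := fun i : ℕ × ℕ => i.2) hi)
    have hAi := hA0 i
    have hSi : 0 ≤ (Finset.Iic (i.1, i.2)).sup (schwartzSeminormFamily ℂ E ℂ) G := apply_nonneg _ _
    have hsingle : A i * (Finset.Iic (i.1, i.2)).sup (schwartzSeminormFamily ℂ E ℂ) G ≤ S :=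
      Finset.single_le_sum (f := fun i : ℕ × ℕ =>
        A i * (Finset.Iic (i.1, i.2)).sup (schwartzSeminormFamily ℂ E ℂ) G)
        (fun j _ => mul_nonneg (hA0 j) (apply_nonneg _ _)) hi
    calc SchwartzMap.seminorm ℂ i.1 i.2 (SchwartzMap.smulLeftCLM ℂ (expMult θ v κ) G)
        ≤ A i * (1 + ‖κ‖) ^ i.2 * ρ * (Finset.Iic (i.1, i.2)).sup (schwartzSeminormFamily ℂ E ℂ) G :=
          hA i κ ρ hρ hw G
      _ = A i * (Finset.Iic (i.1, i.2)).sup (schwartzSeminormFamily ℂ E ℂ) G * (1 + ‖κ‖) ^ i.2 * ρ := by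
          ring
      _ ≤ S * (1 + ‖κ‖) ^ N₀ * ρ := by gcongr
  calc (1 + ‖x‖) ^ M * ‖(𝓕⁻ (SchwartzMap.smulLeftCLM ℂ (expMult θ v κ) G) : 𝓢(E, ℂ)) x‖
      ≤ C * (s.sup (schwartzSeminormFamily ℂ E ℂ)) (SchwartzMap.smulLeftCLM ℂ (expMult θ v κ) G) := h1
    _ ≤ C * (S * (1 + ‖κ‖) ^ N₀ * ρ) := by gcongr
    _ = K * (1 + ‖κ‖) ^ N₀ * ρ := by rw [hK]; ring

/-! ### The inverse Fourier transform as an integral; Fourier shift; holomorphy in `κ` -/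

/-- The inverse Fourier transform of `m_κ G` at `x`, as an integral. [folklore] -/
theorem fourierInv_smulLeftCLM_expMult_apply {θ : ℝ → ℂ} (hθ : ContDiff ℝ ∞ θ)
    (hθc : HasCompactSupport θ) (v : E) (κ : ℂ) (G : 𝓢(E, ℂ)) (x : E) :
    (𝓕⁻ (SchwartzMap.smulLeftCLM ℂ (expMult θ v κ) G) : 𝓢(E, ℂ)) x =
      ∫ p : E, cexp ((2 * Real.pi * ⟪p, x⟫ : ℝ) * I) * (expMult θ v κ p * G p) := by
  rw [SchwartzMap.fourierInv_coe, Real.fourierInv_eq']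
  refine integral_congr_ae (Eventually.of_forall fun p => ?_)
  simp only [smul_eq_mul, smulLeftCLM_expMult_apply hθ hθc]

/-- **Fourier shift**: for real `u`, `𝓕⁻¹(m_u G)(x) = 𝓕⁻¹(m_0 G)(x + u v)` (the multiplier
`e^{2πiu⟨·, v⟩}` translates the inverse Fourier transform). [folklore] -/
theorem fourierInv_smulLeftCLM_expMult_ofReal {θ : ℝ → ℂ} (hθ : ContDiff ℝ ∞ θ)
    (hθc : HasCompactSupport θ) (v : E) (u : ℝ) (G : 𝓢(E, ℂ)) (x : E) :
    (𝓕⁻ (SchwartzMap.smulLeftCLM ℂ (expMult θ v u) G) : 𝓢(E, ℂ)) x =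
      (𝓕⁻ (SchwartzMap.smulLeftCLM ℂ (expMult θ v 0) G) : 𝓢(E, ℂ)) (x + u • v) := by
  rw [fourierInv_smulLeftCLM_expMult_apply hθ hθc v (u : ℂ) G x,
    fourierInv_smulLeftCLM_expMult_apply hθ hθc v 0 G (x + u • v)]
  refine integral_congr_ae (Eventually.of_forall fun p => ?_)
  simp only [expMult_apply, mul_zero, zero_mul, Complex.exp_zero, mul_one,
    inner_add_right, inner_smul_right]
  rw [show cexp (((2 * Real.pi * ⟪p, x⟫ : ℝ) : ℂ) * I) * (θ ⟪p, v⟫ *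
      cexp (2 * Real.pi * I * (u : ℂ) * (⟪p, v⟫ : ℂ)) * G p) =
      (cexp (((2 * Real.pi * ⟪p, x⟫ : ℝ) : ℂ) * I) * cexp (2 * Real.pi * I * (u : ℂ) * (⟪p, v⟫ : ℂ))) *
        (θ ⟪p, v⟫ * G p) by ring, ← Complex.exp_add]
  congr 2
  push_cast
  ring

/-- **Holomorphy in the parameter**: `κ ↦ 𝓕⁻¹(m_κ G)(x)` is an entire function, for every `G`
and `x` (a dominated holomorphic parameter integral over the compact set `{⟨p, v⟩ ∈ supp θ}` in the
exponent variable). [folklore] -/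
theorem differentiable_fourierInv_smulLeftCLM_expMult {θ : ℝ → ℂ} (hθ : ContDiff ℝ ∞ θ)
    (hθc : HasCompactSupport θ) (v : E) (G : 𝓢(E, ℂ)) (x : E) :
    Differentiable ℂ fun κ : ℂ =>
      (𝓕⁻ (SchwartzMap.smulLeftCLM ℂ (expMult θ v κ) G) : 𝓢(E, ℂ)) x := by
  have hfun : (fun κ : ℂ => (𝓕⁻ (SchwartzMap.smulLeftCLM ℂ (expMult θ v κ) G) : 𝓢(E, ℂ)) x) =
      fun κ : ℂ => ∫ p : E, cexp ((2 * Real.pi * ⟪p, x⟫ : ℝ) * I) * (expMult θ v κ p * G p) :=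
    funext fun κ => fourierInv_smulLeftCLM_expMult_apply hθ hθc v κ G x
  rw [hfun]
  -- a bound for `θ` and for `|r|` on its support
  obtain ⟨B, hB⟩ := hθc.exists_bound_of_continuous hθ.continuous
  obtain ⟨R, hR⟩ := (hθc.isCompact.isBounded).subset_closedBall 0
  have hR' : ∀ r ∈ tsupport θ, |r| ≤ R := fun r hr => by simpa using hR hr
  have hB0 : 0 ≤ B := (norm_nonneg _).trans (hB 0)
  refine differentiableOn_univ.1 ?_
  refine Literature.Analysis.Complex.differentiableOn_integral_of_dominated (μ := volume)
    (F := fun κ p => cexp ((2 * Real.pi * ⟪p, x⟫ : ℝ) * I) * (expMult θ v κ p * G p)) ?_ ?_ ?_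
  · intro κ _
    refine (Continuous.mul ?_ (((contDiff_expMult hθ v κ).continuous).mul G.continuous)).aestronglyMeasurable
    exact Complex.continuous_exp.comp ((Complex.continuous_ofReal.comp
      (continuous_const.mul (continuous_id.inner continuous_const))).mul continuous_const)
  · refine Eventually.of_forall fun p => ?_
    refine (differentiableOn_const _).mul (DifferentiableOn.mul ?_ (differentiableOn_const _))
    intro κ _
    refine DifferentiableAt.differentiableWithinAt ?_
    simp only [expMult_apply]
    refine (differentiableAt_const _).mul ?_
    exact (((differentiableAt_const _).mul differentiableAt_id).mul (differentiableAt_const _)).cexp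
  · intro κ₀ _
    refine ⟨1, one_pos, subset_univ _, fun p => B * Real.exp (2 * Real.pi * (‖κ₀‖ + 1) * R) * ‖G p‖,
      (G.integrable.norm.const_mul _), Eventually.of_forall fun p κ hκ => ?_⟩
    have hκ' : ‖κ‖ ≤ ‖κ₀‖ + 1 := by
      have := mem_ball_iff_norm.1 hκ
      calc ‖κ‖ = ‖κ₀ + (κ - κ₀)‖ := by rw [add_sub_cancel]
        _ ≤ ‖κ₀‖ + ‖κ - κ₀‖ := norm_add_le _ _
        _ ≤ ‖κ₀‖ + 1 := by linarith
    rw [norm_mul, norm_mul, Complex.norm_exp_ofReal_mul_I, one_mul]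
    refine mul_le_mul_of_nonneg_right ?_ (norm_nonneg _)
    by_cases hp : ⟪p, v⟫ ∈ tsupport θ
    · rw [expMult_apply, norm_mul, Complex.norm_exp]
      refine mul_le_mul (hB _) ?_ (by positivity) hB0
      refine Real.exp_le_exp.2 ?_
      have hre : (2 * (Real.pi : ℂ) * I * κ * (⟪p, v⟫ : ℂ)).re = -(2 * Real.pi * κ.im * ⟪p, v⟫) := by
        simp [Complex.mul_re, Complex.mul_im]
      rw [hre]
      have h1 : |κ.im| ≤ ‖κ‖ := Complex.abs_im_le_norm κ
      have h2 : |⟪p, v⟫| ≤ R := hR' _ hp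
      have h3 : -(2 * Real.pi * κ.im * ⟪p, v⟫) ≤ 2 * Real.pi * (|κ.im| * |⟪p, v⟫|) := by
        have := neg_abs_le (κ.im * ⟪p, v⟫)
        rw [abs_mul] at this
        nlinarith [Real.pi_pos]
      have h4 : |κ.im| * |⟪p, v⟫| ≤ (‖κ₀‖ + 1) * R :=
        mul_le_mul (h1.trans hκ') h2 (abs_nonneg _) (by positivity)
      nlinarith [Real.pi_pos]
    · have h0 : expMult θ v κ p = 0 := by
        have : θ ⟪p, v⟫ = 0 := image_eq_zero_of_notMem_tsupport hp
        simp [expMult_apply, this]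
      rw [h0, norm_zero]
      positivity

end Fourier

/-! ### The two standard weights -/

/-- Generic weight: if `supp θ ⊆ [−R, R]` then `e^{−2π Im κ r} ≤ e^{2π‖κ‖R}` on `supp θ`. [folklore] -/
theorem exp_neg_le_exp_norm {θ : ℝ → ℂ} {R : ℝ} (hR : ∀ r ∈ tsupport θ, |r| ≤ R) (κ : ℂ) :
    ∀ r ∈ tsupport θ, Real.exp (-(2 * Real.pi * κ.im * r)) ≤ Real.exp (2 * Real.pi * ‖κ‖ * R) := by
  intro r hr
  refine Real.exp_le_exp.2 ?_
  have h1 : |κ.im| ≤ ‖κ‖ := Complex.abs_im_le_norm κ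
  have h2 := hR r hr
  have h3 : -(κ.im * r) ≤ |κ.im| * |r| := by
    have := neg_abs_le (κ.im * r); rw [abs_mul] at this; linarith
  have h4 : |κ.im| * |r| ≤ ‖κ‖ * R := mul_le_mul h1 h2 (abs_nonneg _) (norm_nonneg _)
  nlinarith [Real.pi_pos]

/-- **The Paley–Wiener weight**: if `supp θ ⊆ [ε, ∞)` then for `κ = is`, `s ≥ 0`,
`e^{−2π Im κ r} ≤ e^{−2πsε}` on `supp θ` — exponential decay in `s` when `ε > 0`. [folklore] -/
theorem exp_neg_le_exp_neg_of_le {θ : ℝ → ℂ} {ε : ℝ} (hε : ∀ r ∈ tsupport θ, ε ≤ r) {s : ℝ}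
    (hs : 0 ≤ s) : ∀ r ∈ tsupport θ,
      Real.exp (-(2 * Real.pi * (I * (s : ℂ)).im * r)) ≤ Real.exp (-(2 * Real.pi * s * ε)) := by
  intro r hr
  refine Real.exp_le_exp.2 ?_
  have him : (I * (s : ℂ)).im = s := by simp
  rw [him]
  have := hε r hr
  nlinarith [Real.pi_pos, mul_nonneg hs (sub_nonneg.2 this)]

end Literature.Analysis.FunctionSpaces
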